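import Summits.CriticalPhenomena.SAWScalingLimit.Theses.SAWRestrictionRigidity
import Summits.CriticalPhenomena.SAWScalingLimit.Theorems.SAWRestrictionRigidityRigidityClosureHomeomorph
import Summits.CriticalPhenomena.SAWScalingLimit.Theorems.SAWRestrictionRigidityRigidityPushforwardCarried
import Summits.CriticalPhenomena.SAWScalingLimit.Theorems.SAWRestrictionRigidityRigidityPreimageSubdomain
import Summits.CriticalPhenomena.SAWScalingLimit.Theorems.SAWRestrictionRigidityRigidityCovarianceOfCocycle

/-!
# The reduction `rigidity_of_cocycleCore` (line `registered`, scalar / avoidance-cocycle cut), crux `Rigidity` (stmt-CriticalPhenomena-1368), route SAWRestrictionRigidity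

Target: `Summits/CriticalPhenomena/SAWScalingLimit/Theorems/SAWRestrictionRigidityRigidityOfCocycleCore.lean` (`--supports stmt-CriticalPhenomena-1368`).
The kernel-checked implication "scalar core ⇒ crux": whoever proves the conformal invariance of the
avoidance cocycle under the crux hypotheses closes the crux by applying this theorem.
-/

noncomputable section

namespace Summit.CriticalPhenomena.SAWScalingLimit.Cruxes.Rigidity.Cocycle

open MeasureTheory
open Literature.Probability.RandomPlanarGeometry

/-- **The crux `Rigidity` reduces to its scalar core** (line `registered`, lead c2): if, under the crux hypotheses, the avoidance cocycle `c(D, D') = P D {γ ⊆ closure D'}` is conformally invariant (statement of `stub_cocycleConformal`), then `Rigidity` holds — assembled BY NAME from the four landed bookkeeping theorems `stub_closureHomeomorph` (p148398), `stub_pushforwardCarried` (p148424), `stub_preimageSubdomain` (p148391) and `stub_covarianceOfCocycle` (p148944): cocycle invariance + chordality + simple boundary-avoiding curves ⇒ `IsConformallyCovariant` via `AvoidanceDeterminesLaw_proof`. Together with the certificate `core_of_rigidity` (crux workfile `Lines/registered_CoreOfRigidity.lean`) this makes the crux kernel-equivalent to the scalar core. [folklore] -/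
theorem rigidity_of_cocycleCore : (∀ P : Literature.Probability.RandomPlanarGeometry.ChordalFamily, P.IsChordal → P.IsRestriction → (∃ Q : Literature.Probability.RandomPlanarGeometry.DobrushinDomain → Literature.Probability.RandomPlanarGeometry.CurveClass ℂ → MeasureTheory.Measure (Literature.Probability.RandomPlanarGeometry.CurveClass ℂ), P.IsMarkovExtension Q ∧ ∀ (D : Literature.Probability.RandomPlanarGeometry.DobrushinDomain) (p : Literature.Probability.RandomPlanarGeometry.CurveClass ℂ) (D' : Literature.Probability.RandomPlanarGeometry.DobrushinDomain), D'.carrier ⊆ Literature.Probability.RandomPlanarGeometry.remainingDomain D p → D'.pt 0 = p.target → D'.pt 1 = D.pt 1 → ∀ T : Set (Literature.Probability.RandomPlanarGeometry.CurveClass ℂ), MeasurableSet T → P D' T * Q D p (Literature.Probability.RandomPlanarGeometry.CurveClass.rangeSubset (closure D'.carrier)) = Q D p (T ∩ Literature.Probability.RandomPlanarGeometry.CurveClass.rangeSubset (closure D'.carrier))) → (∀ D D' : Literature.Probability.RandomPlanarGeometry.DobrushinDomain, D'.carrier = D.carrier → D'.pt 0 = D.pt 1 → D'.pt 1 = D.pt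 0 → P D' = (P D).map Literature.Probability.RandomPlanarGeometry.CurveClass.reverse) → (∀ (D : Literature.Probability.RandomPlanarGeometry.DobrushinDomain) (c : ℂ) (hc : c ≠ 0) (w : ℂ), (∃ (r : ℝ) (k : ℕ), 0 < r ∧ c = (r : ℂ) * Complex.I ^ k) → P (D.map (Literature.Probability.RandomPlanarGeometry.similarity c hc w)) = (P D).map (Literature.Probability.RandomPlanarGeometry.CurveClass.map (Literature.Probability.RandomPlanarGeometry.similarity c hc w : C(ℂ, ℂ)))) → (∀ D : Literature.Probability.RandomPlanarGeometry.DobrushinDomain, P (D.map Complex.conjLIE.toHomeomorph) = (P D).map (Literature.Probability.RandomPlanarGeometry.CurveClass.map (Complex.conjLIE.toHomeomorph : C(ℂ, ℂ)))) → (∀ D : Literature.Probability.RandomPlanarGeometry.DobrushinDomain, ∀ᵐ γ ∂(P D), γ ∈ Literature.Probability.RandomPlanarGeometry.CurveClass.simple ∧ γ.range ∩ frontier D.carrier ⊆ {D.pt 0, D.pt 1}) → ∀ (D D₂ : Literature.Probability.RandomPlanarGeometry.DobrushinDomain) (g : Literature.Probability.RandomPlanarGeometry.ConformalEquiv D.carrier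 D₂.carrier) (Φ : C(ℂ, ℂ)), g.HasBoundaryValue (D.pt 0) (D₂.pt 0) → g.HasBoundaryValue (D.pt 1) (D₂.pt 1) → Set.EqOn Φ g D.carrier → Set.InjOn Φ (closure D.carrier) → ∀ (D' D₂' : Literature.Probability.RandomPlanarGeometry.DobrushinDomain), D'.carrier ⊆ D.carrier → D'.pt 0 = D.pt 0 → D'.pt 1 = D.pt 1 → D₂'.carrier ⊆ D₂.carrier → D₂'.pt 0 = D₂.pt 0 → D₂'.pt 1 = D₂.pt 1 → (∃ ε : ℝ, 0 < ε ∧ D'.carrier ∩ Metric.ball (D.pt 0) ε = D.carrier ∩ Metric.ball (D.pt 0) ε ∧ D'.carrier ∩ Metric.ball (D.pt 1) ε = D.carrier ∩ Metric.ball (D.pt 1) ε) → (∃ ε : ℝ, 0 < ε ∧ D₂'.carrier ∩ Metric.ball (D₂.pt 0) ε = D₂.carrier ∩ Metric.ball (D₂.pt 0) ε ∧ D₂'.carrier ∩ Metric.ball (D₂.pt 1) ε = D₂.carrier ∩ Metric.ball (D₂.pt 1) ε) → Φ '' closure D'.carrier = closure D₂'.carrier → P D (Literature.Probability.RandomPlanarGeometry.CurveClass.rangeSubset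 (closure D'.carrier)) = P D₂ (Literature.Probability.RandomPlanarGeometry.CurveClass.rangeSubset (closure D₂'.carrier))) → Summit.CriticalPhenomena.SAWScalingLimit.Theses.SAWRestrictionRigidity.Rigidity := by
  intro hcore P hch hres hmk hrev hsim hconj hsimple
  exact stub_covarianceOfCocycle stub_closureHomeomorph stub_pushforwardCarried stub_preimageSubdomain
    P hch hsimple (hcore P hch hres hmk hrev hsim hconj hsimple)

end Summit.CriticalPhenomena.SAWScalingLimit.Cruxes.Rigidity.Cocycle

end
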